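import Summits.ABC.StewartYu.PadicG3TwoFirstExpSat
import Summits.ABC.StewartYu.PadicG3TwoSatSupply
import Summits.ABC.StewartYu.PadicG3TwoClose
import HarnessLib

/-!
# Cell abc-stewartyu, WP-L.P(2) (crux r4 `PadicCoreTwoRat`, stmt-ABC-20504), line `padic-two-sat-frame`: the SMALLNESS PACK of the
# 𝔑-threaded schedule of record from the GAIN PACK and the headline — `GainSupplyTwoN → SmallSupplyTwoN C` for `C(n) ≥ 2^{111 n}`

`Summits/ABC/StewartYu/PadicG3TwoSatSmall.lean` — cell `abc-stewartyu` (HOME `run/shared/lean/pub/abc-stewartyu/`), route `YuMatveevShapeRat`,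
seat lp-1 g8 (taker of `stub_smallTwoN`, STATUS 2026-08-27 ≈19:5xZ; p3 memo-13 §1).  Theorems only; no named fact, no new definition.

THE POINT (as in the non-saturated closer `PadicG3TwoClose`, p3 g6): the `‖Λ₀‖`-branch of every k-step / third-step inequality of the frame
is BELOW its gain branch as soon as `‖Λ₀‖ ≤ 2^{−e}` with `e` the branch's smallness exponent (`PadicG3TwoFirstBranch.first_le_gain`,
schedule-generic), and along `schedTwoN` every such exponent is `≤ E := (m+6)·(d+3)·3^{d+6}·X·L` (`PadicG3TwoFirstExpSat`).  The negated crux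
bound gives `‖Λ₀‖ ≤ |b̃_θ|·2^{−U}` with `C(d+1)·∏V·(W + log 2Vmax) < U + 1`; the size datum `|b̃_θ| ≤ (d+1)(d+1)!·N·e^W`, `N ≤ (2/log 2)^{d+1}∏V`
and p3's HEADLINE `headline_two` (`(m+6)(n+2)3^{n+4}XL + m + 3 + ⌈2W⌉ ≤ 2^{110n}·∏V·(W + log 2Vmax)`, `n = d+1`) give
`‖Λ₀‖ ≤ 2^{−(E + m + 3)}` whenever `C(n) ≥ 2^{111 n}` (the spare factor `2ⁿ ≥ 4` pays the factor `3` of the floored schedule and the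
`log₂((d+1)(d+1)!·N)` of the saturated coefficient bound).  Hence:

* `smallPackTwoN_of_gain` — per set-up: size data (s3), (s4) + `GainPackTwoN` + the smallness ⇒ `SmallPackTwoN`;
* **`smallSupplyTwoN_of_gainSupply`** — `GainSupplyTwoN → SmallSupplyTwoN C` for any `C` with `2^{111·r} ≤ C r`: the line's `stub_smallTwoN`
  (`SmallSupplyTwoN CLine`, `CLine r = (2^111)^r`) follows from `stub_gainTwoN` — no separate sizes file is needed for the smallness pack.

WHAT THIS IS NOT: the gain pack (`stub_gainTwoN`, p3); no crux moves (A1.L not moved).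

References: K. Yu, Acta Math. 211 (2013), Lemma 5.1–5.2 (5.19), (5.29), Lemma 5.4 (5.62); K. Yu, Forum Math. 19 (2007) (p = 2 main theorem;
shape only); Yu. V. Nesterenko, LNM 1819 (2003) §4.2, §5.
-/

noncomputable section

open Finset
open Literature.NumberTheory.Transcendental
open Literature.NumberTheory.Transcendental.CW77 (heightProd)
open Literature.NumberTheory.Transcendental.CW77.Setup (Tau tauNorm)
open Literature.NumberTheory.Transcendental.PadicCW77 (condExp)
open scoped Nat

namespace Summit.ABC.StewartYu

namespace TwoSetup

open Summit.ABC.StewartYu.PadicG3Par Summit.ABC.StewartYu.ParTwo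

/-! ### Two crude dyadic exponents -/

/-- `n·n! ≤ 2^{n·n}` (`n ≥ 1`; `n ≤ 2^{n−1}`). [folklore] -/
theorem mul_factorial_le_two_pow (n : ℕ) : n * n ! ≤ 2 ^ (n * n) := by
  induction n with
  | zero => simp
  | succ k ih =>
    rcases Nat.eq_zero_or_pos k with h0 | hk
    · subst h0; simp
    · -- `(k+1)·(k+1)! = (k+1)²·k! ≤ (k+1)·(k·k!)·… ` crude: `(k+1)(k+1)! = (k+1)^2 · k!` and `k! ≤ k·k! ≤ 2^{k k}`, `(k+1)^2 ≤ 2^{2k+1}`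
      have h1 : (k + 1) * (k + 1)! = (k + 1) * (k + 1) * k ! := by rw [Nat.factorial_succ]; ring
      have h2 : k ! ≤ 2 ^ (k * k) := le_trans (Nat.le_mul_of_pos_left _ hk) ih
      have h3 : (k + 1) * (k + 1) ≤ 2 ^ (2 * k + 1) := by
        have h4 : k + 1 ≤ 2 ^ k := Nat.lt_two_pow_self
        calc (k + 1) * (k + 1) ≤ 2 ^ k * 2 ^ k := Nat.mul_le_mul h4 h4
          _ = 2 ^ (2 * k) := by rw [← pow_add]; ring_nf
          _ ≤ 2 ^ (2 * k + 1) := Nat.pow_le_pow_right (by norm_num) (by omega)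
      calc (k + 1) * (k + 1)! = (k + 1) * (k + 1) * k ! := h1
        _ ≤ 2 ^ (2 * k + 1) * 2 ^ (k * k) := Nat.mul_le_mul h3 h2
        _ = 2 ^ (2 * k + 1 + k * k) := by rw [← pow_add]
        _ ≤ 2 ^ ((k + 1) * (k + 1)) := Nat.pow_le_pow_right (by norm_num) (by nlinarith)

/-- `(d+1)² + 2(d+1) + 3 ≤ 2^{110(d+1)}` (crude). [folklore] -/
theorem sq_add_le_two_pow (d : ℕ) : (d + 1) * (d + 1) + 2 * (d + 1) + 3 ≤ 2 ^ (110 * (d + 1)) := by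
  have h5 : d + 1 ≤ 2 ^ d := Nat.lt_two_pow_self
  have h55 : (d + 1) * (d + 1) ≤ 2 ^ (d + d) := by rw [pow_add]; exact Nat.mul_le_mul h5 h5
  have h1 : d + 1 ≤ 2 ^ (d + d) := h5.trans (Nat.pow_le_pow_right (by norm_num) (by omega))
  have h0 : 1 ≤ 2 ^ (d + d) := Nat.one_le_two_pow
  calc (d + 1) * (d + 1) + 2 * (d + 1) + 3 ≤ 8 * 2 ^ (d + d) := by omega
    _ = 2 ^ (d + d + 3) := by rw [pow_add]; ring
    _ ≤ 2 ^ (110 * (d + 1)) := Nat.pow_le_pow_right (by norm_num) (by omega)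

/-! ### The smallness pack from the gain pack -/

variable (S : TwoSetup) (F : S.SatData)

/-- **THE SMALLNESS PACK OF `schedTwoN` FROM ITS GAIN PACK AND THE HEADLINE** (one set-up).  Size data: `|b̃ₖ| ≤ (d+1)(d+1)!·N·e^W`,
`N ≤ (2/log 2)^{d+1}·∏V`; the gain pack of the record `parTwo V Vmax W`; a natural `U` with `C(d+1)·∏V·(W + log 2Vmax) < U + 1`,
`2^{111(d+1)} ≤ C(d+1)`; and `‖Λ₀‖ ≤ |b̃_θ|·2^{−U}`.  Then `SmallPackTwoN`: the slab smallness `‖Λ₀‖ ≤ 2^{−(m+3)}` and every `‖Λ₀‖`-branch,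
each below its gain branch by `first_le_gain`. [cite: Yu2013, Lemma 5.1–5.2 (5.19), (5.29), Lemma 5.4 (5.62); shape only] -/
theorem smallPackTwoN_of_gain (V : Fin (S.d + 1) → ℝ) (Vmax W : ℝ) (Ucol : Fin (S.d + 1) → ℕ) (hd : 1 ≤ S.d)
    (hV1 : ∀ j, 1 ≤ V j) (hVmax : ∀ j, V j ≤ Vmax) (hW1 : 1 ≤ W)
    (hs3 : ∀ k, (|S.ball k| : ℝ) ≤ (((S.d + 1) * (S.d + 1)! : ℕ) : ℝ) * F.N * Real.exp W)
    (hs4 : (F.N : ℝ) ≤ (2 / Real.log 2) ^ (S.d + 1) * ∏ j, V j)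
    (hG : S.GainPackTwoN F (parTwo V Vmax W hV1 hVmax hW1) Ucol)
    {C : ℕ → ℝ} (hC : (2 : ℝ) ^ (111 * (S.d + 1)) ≤ C (S.d + 1)) (U : ℕ)
    (hU : C (S.d + 1) * (∏ j, V j) * (W + Real.log (2 * Vmax)) < U + 1)
    (hΛ : ‖S.Λ₀‖ ≤ |(S.bθ : ℝ)| * (2 : ℝ) ^ (-(U : ℤ))) :
    S.SmallPackTwoN F (parTwo V Vmax W hV1 hVmax hW1) Ucol := by
  set P : PadicG3Par (S.d + 1) := parTwo V Vmax W hV1 hVmax hW1 with hPdef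
  -- record facts
  have hp : P.p = 2 := parTwo_p V Vmax W hV1 hVmax hW1
  have hK₀ : P.K₀ = 1 := parTwo_K₀ V Vmax W hV1 hVmax hW1
  have hθ : (1 / 2 : ℝ) ≤ P.θ₀ := parTwo_half_le_θ₀ V Vmax W hV1 hVmax hW1
  have hNqK : P.Nq ≤ 2 ^ (S.d + 1) * P.K := parTwo_Nq_le V Vmax W hV1 hVmax hW1 hd
  have hAmaxΩ : P.Amax ≤ 2 ^ (S.d + 1) * P.Ω := parTwo_Amax_le V Vmax W hV1 hVmax hW1
  have hAmaxV : P.Amax ≤ Vmax := parTwo_Amax_le_Vmax V Vmax W hV1 hVmax hW1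
  have hA1 : ∀ j, 1 ≤ P.A j := hV1
  have hΩ : P.Ω = ∏ j, V j := parTwo_Ω V Vmax W hV1 hVmax hW1
  have hWP : P.W = W := rfl
  have hVmax1 : 1 ≤ Vmax := (hV1 0).trans (hVmax 0)
  have hprod1 : 1 ≤ ∏ j, V j := by
    calc (1 : ℝ) = ∏ _j : Fin (S.d + 1), (1 : ℝ) := by simp
      _ ≤ ∏ j, V j := prod_le_prod (fun _ _ => zero_le_one) fun j _ => hV1 j
  have hprod0 : 0 ≤ ∏ j, V j := zero_le_one.trans hprod1
  have hlog2 : Real.log 2 ≤ Real.log (2 * Vmax) := Real.log_le_log (by norm_num) (by linarith)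
  have hl2 := Real.log_two_gt_d9
  have hW' : 1 ≤ W + Real.log (2 * Vmax) := by linarith
  set W' : ℝ := W + Real.log (2 * Vmax) with hW'def
  -- the exponents
  set E : ℕ := (P.m + 6) * ((S.d + 3) * (3 ^ (S.d + 6) * (P.X * P.L))) with hE
  set H0 : ℕ := (P.m + 6) * ((S.d + 1 + 2) * (3 ^ (S.d + 1 + 4) * (P.X * P.L))) with hH0
  have hEH : E = 3 * H0 := by
    rw [hE, hH0, show S.d + 1 + 2 = S.d + 3 by ring, show S.d + 6 = (S.d + 1 + 4) + 1 by ring, pow_succ]; ring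
  set kb : ℕ := (S.d + 1) * (S.d + 1) with hkb
  set kN : ℕ := 2 * (S.d + 1) + ⌈∏ j, V j⌉₊ with hkN
  set Utot : ℕ := E + (P.m + 3) + ⌈2 * W⌉₊ + kb + kN with hUtot
  -- (1) the size of `|b̃_θ|` in dyadic form: `|b̃_θ| ≤ 2^{kb}·2^{kN}·2^{⌈2W⌉}`
  have hfac : (((S.d + 1) * (S.d + 1)! : ℕ) : ℝ) ≤ (2 : ℝ) ^ kb := by
    rw [hkb]; exact_mod_cast mul_factorial_le_two_pow (S.d + 1)
  have hN2 : (F.N : ℝ) ≤ (2 : ℝ) ^ kN := by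
    have h1 : (2 / Real.log 2 : ℝ) ^ (S.d + 1) ≤ (2 : ℝ) ^ (2 * (S.d + 1)) := by
      rw [pow_mul]
      refine pow_le_pow_left₀ (by positivity) ?_ _
      rw [div_le_iff₀ (by linarith)]
      norm_num
      linarith
    have h2 : (∏ j, V j) ≤ (2 : ℝ) ^ ⌈∏ j, V j⌉₊ := by
      refine le_trans (Nat.le_ceil _) ?_
      exact_mod_cast (Nat.lt_two_pow_self (n := ⌈∏ j, V j⌉₊)).le
    rw [hkN, pow_add]
    exact hs4.trans (mul_le_mul h1 h2 hprod0 (by positivity))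
  have hbθ : |(S.bθ : ℝ)| ≤ (2 : ℝ) ^ kb * (2 : ℝ) ^ kN * (2 : ℝ) ^ ⌈2 * W⌉₊ := by
    have h1 := hs3 (Fin.last S.d)
    have e1 : S.ball (Fin.last S.d) = S.bθ := by unfold ball; rw [Fin.snoc_last]
    rw [e1] at h1
    refine h1.trans ?_
    have h2 := exp_le_two_pow_ceil W
    have hN0 : (0 : ℝ) ≤ F.N := Nat.cast_nonneg _
    have h2kb : (0 : ℝ) ≤ (2 : ℝ) ^ kb := by positivity
    have h2kk : (0 : ℝ) ≤ (2 : ℝ) ^ kb * (2 : ℝ) ^ kN := by positivity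
    have h3 : (((S.d + 1) * (S.d + 1)! : ℕ) : ℝ) * F.N * Real.exp W ≤ (2 : ℝ) ^ kb * (2 : ℝ) ^ kN * (2 : ℝ) ^ ⌈2 * W⌉₊ :=
      mul_le_mul (mul_le_mul hfac hN2 hN0 h2kb) h2 (Real.exp_pos _).le h2kk
    exact h3
  -- (2) the headline: `Utot + 1 ≤ 2^{111 n}·∏V·W' ≤ C(n)·∏V·W' < U + 1`, so `Utot ≤ U`
  have hhead := P.headline_two hp hK₀ hθ hNqK hAmaxΩ hA1
  have hH0W : ((H0 + P.m + 3 + ⌈2 * P.W⌉₊ : ℕ) : ℝ) ≤ (2 : ℝ) ^ (110 * (S.d + 1)) * (∏ j, V j) * W' := by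
    refine hhead.trans ?_
    have hlogV : Real.log (2 * P.Amax) ≤ Real.log (2 * Vmax) := Real.log_le_log (by linarith [P.hAmax1]) (by linarith)
    rw [hΩ, hWP, hW'def]
    exact mul_le_mul_of_nonneg_left (by linarith) (by positivity)
  have hn2 : 2 ≤ S.d + 1 := by omega
  have hsmall : ((kb + kN : ℕ) : ℝ) + 1 ≤ (2 : ℝ) ^ (110 * (S.d + 1)) * (∏ j, V j) * W' := by
    -- `kb + kN + 1 ≤ n² + 2n + ∏V + 2 ≤ (n² + 2n + 3)·∏V·W' ≤ 2^{110n}·∏V·W'`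
    have h1 : ((kb + kN : ℕ) : ℝ) + 1 ≤ ((S.d + 1) * (S.d + 1) + 2 * (S.d + 1) + 3 : ℕ) * ((∏ j, V j) * W') := by
      have hc : (⌈∏ j, V j⌉₊ : ℝ) ≤ (∏ j, V j) + 1 := (Nat.ceil_lt_add_one hprod0).le
      have hPW : (∏ j, V j) ≤ (∏ j, V j) * W' := le_mul_of_one_le_right hprod0 hW'
      have hPW1 : 1 ≤ (∏ j, V j) * W' := hprod1.trans hPW
      set A : ℝ := (((S.d + 1) * (S.d + 1) + 2 * (S.d + 1) : ℕ) : ℝ) with hA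
      have hA0 : 0 ≤ A := Nat.cast_nonneg _
      have hA1 : A ≤ A * ((∏ j, V j) * W') := le_mul_of_one_le_right hA0 hPW1
      have e1 : ((kb + kN : ℕ) : ℝ) = A + (⌈∏ j, V j⌉₊ : ℝ) := by rw [hkb, hkN, hA]; push_cast; ring
      have e2 : ((((S.d + 1) * (S.d + 1) + 2 * (S.d + 1) + 3 : ℕ) : ℝ)) = A + 3 := by rw [hA]; push_cast; ring
      rw [e1, e2]
      have e3 : (A + 3) * ((∏ j, V j) * W') = A * ((∏ j, V j) * W') + 3 * ((∏ j, V j) * W') := by ring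
      rw [e3]
      linarith
    have h2 : (((S.d + 1) * (S.d + 1) + 2 * (S.d + 1) + 3 : ℕ) : ℝ) ≤ (2 : ℝ) ^ (110 * (S.d + 1)) := by
      exact_mod_cast sq_add_le_two_pow S.d
    calc ((kb + kN : ℕ) : ℝ) + 1 ≤ ((S.d + 1) * (S.d + 1) + 2 * (S.d + 1) + 3 : ℕ) * ((∏ j, V j) * W') := h1
      _ ≤ (2 : ℝ) ^ (110 * (S.d + 1)) * ((∏ j, V j) * W') := mul_le_mul_of_nonneg_right h2 (by positivity)
      _ = (2 : ℝ) ^ (110 * (S.d + 1)) * (∏ j, V j) * W' := by ring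
  have hUtotU : Utot ≤ U := by
    have h4 : (4 : ℝ) * (2 : ℝ) ^ (110 * (S.d + 1)) ≤ (2 : ℝ) ^ (111 * (S.d + 1)) := by
      have : (2 : ℝ) ^ (111 * (S.d + 1)) = (2 : ℝ) ^ (S.d + 1) * (2 : ℝ) ^ (110 * (S.d + 1)) := by rw [← pow_add]; ring_nf
      rw [this]
      refine mul_le_mul_of_nonneg_right ?_ (by positivity)
      calc (4 : ℝ) = 2 ^ 2 := by norm_num
        _ ≤ 2 ^ (S.d + 1) := pow_le_pow_right₀ (by norm_num) hn2
    have hUtotR : (Utot : ℝ) + 1 ≤ C (S.d + 1) * (∏ j, V j) * W' := by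
      have e1 : (Utot : ℝ) + 1 = 3 * (H0 : ℝ) + (P.m + 3 + ⌈2 * W⌉₊ : ℕ) + (((kb + kN : ℕ) : ℝ) + 1) := by
        rw [hUtot, hEH]; push_cast; ring
      have e2 : ((H0 + P.m + 3 + ⌈2 * P.W⌉₊ : ℕ) : ℝ) = (H0 : ℝ) + ((P.m + 3 + ⌈2 * W⌉₊ : ℕ) : ℝ) := by
        rw [hWP]; push_cast; ring
      rw [e2] at hH0W
      have hm0 : (0 : ℝ) ≤ ((P.m + 3 + ⌈2 * W⌉₊ : ℕ) : ℝ) := Nat.cast_nonneg _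
      have hB0 : (0 : ℝ) ≤ (2 : ℝ) ^ (110 * (S.d + 1)) * (∏ j, V j) * W' := by positivity
      rw [e1]
      calc 3 * (H0 : ℝ) + ((P.m + 3 + ⌈2 * W⌉₊ : ℕ) : ℝ) + (((kb + kN : ℕ) : ℝ) + 1)
          ≤ 3 * ((2 : ℝ) ^ (110 * (S.d + 1)) * (∏ j, V j) * W') + (2 : ℝ) ^ (110 * (S.d + 1)) * (∏ j, V j) * W' := by
            linarith
        _ = (4 * (2 : ℝ) ^ (110 * (S.d + 1))) * ((∏ j, V j) * W') := by ring
        _ ≤ (2 : ℝ) ^ (111 * (S.d + 1)) * ((∏ j, V j) * W') := mul_le_mul_of_nonneg_right h4 (by positivity)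
        _ ≤ C (S.d + 1) * ((∏ j, V j) * W') := mul_le_mul_of_nonneg_right hC (by positivity)
        _ = C (S.d + 1) * (∏ j, V j) * W' := by ring
    have h5 : (Utot : ℝ) < U + 1 := by linarith [hUtotR, hU]
    have h6 : Utot < U + 1 := by exact_mod_cast h5
    omega
  -- (3) `‖Λ₀‖ ≤ 2^{−(E + m + 3)}`
  have hΛall : ‖S.Λ₀‖ ≤ ((2 : ℝ) ^ (E + (P.m + 3)))⁻¹ := by
    have h2U : (2 : ℝ) ^ (-(U : ℤ)) ≤ ((2 : ℝ) ^ Utot)⁻¹ := by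
      rw [zpow_neg, zpow_natCast]
      exact inv_anti₀ (by positivity) (pow_le_pow_right₀ (by norm_num) hUtotU)
    have hsplit : (2 : ℝ) ^ Utot = (2 : ℝ) ^ (E + (P.m + 3)) * ((2 : ℝ) ^ kb * (2 : ℝ) ^ kN * (2 : ℝ) ^ ⌈2 * W⌉₊) := by
      rw [hUtot]; simp only [pow_add]; ring
    have hpos1 : (0 : ℝ) < (2 : ℝ) ^ (E + (P.m + 3)) := by positivity
    have hpos2 : (0 : ℝ) < (2 : ℝ) ^ kb * (2 : ℝ) ^ kN * (2 : ℝ) ^ ⌈2 * W⌉₊ := by positivity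
    calc ‖S.Λ₀‖ ≤ |(S.bθ : ℝ)| * (2 : ℝ) ^ (-(U : ℤ)) := hΛ
      _ ≤ ((2 : ℝ) ^ kb * (2 : ℝ) ^ kN * (2 : ℝ) ^ ⌈2 * W⌉₊) * ((2 : ℝ) ^ Utot)⁻¹ :=
          mul_le_mul hbθ h2U (by positivity) (by positivity)
      _ = ((2 : ℝ) ^ (E + (P.m + 3)))⁻¹ := by
          rw [hsplit, mul_inv]
          field_simp
  have hΛE : ‖S.Λ₀‖ ≤ ((2 : ℝ) ^ E)⁻¹ := le_inv_two_pow_of_le (by omega) hΛall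
  have hBw : 0 ≤ S.Bw3N F P := by
    have := S.Bw3N_ge F P 0 (Nat.zero_le _)
    exact le_trans (by positivity) this
  -- (4) the pack
  have hslab : ‖S.Λ₀‖ ≤ ((2 : ℝ) ^ (P.m + 3))⁻¹ := le_inv_two_pow_of_le (by omega) hΛall
  have hk0 : ∀ k, k < S.d + 3 → ∀ x₁ : ℤ, |x₁| ≤ (S.Nsub3N P 0 (k + 1) : ℤ) → ∀ τ : Tau S.d,
      tauNorm τ + S.T3N P 0 ≤ S.T03N F P 0 - k * S.T3N P 0 →
      S.Bw3N F P * ‖S.Λ₀‖ * (2 : ℝ) ^ S.T3N P 0 * (2 : ℝ) ^ condExp 2 (2 * S.Nsub3N P 0 k + 1) (S.T3N P 0) <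
        1 / KTwoSat (S.schedTwoN F P) F (S.Bv3N F P) 0 x₁ τ := by
    intro k hk x₁ hx₁ τ hτ
    have he := S.kExpA_schedTwoN_le F P (k := k) hk
    simp only [schedTwoN_tdec, schedTwoN_Nsub, schedTwoN_m] at he
    exact lt_of_le_of_lt (first_le_gain hBw (le_inv_two_pow_of_le he hΛE)) (hG.kstep0 k hk x₁ hx₁ τ hτ)
  have hk : ∀ I, 1 ≤ I → I ≤ S.Istar3N F P → ∀ k, k < S.d + 3 → ∀ x₁ : ℤ, |x₁| ≤ (S.Nsub3N P I (k + 1) : ℤ) →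
      ∀ τ : Tau S.d, tauNorm τ + S.T3N P I ≤ S.T03N F P I - k * S.T3N P I →
      S.Bw3N F P * ‖S.Λ₀‖ * (2 : ℝ) ^ S.T3N P I * (2 : ℝ) ^ condExp 2 (2 * S.Nsub3N P I k + 1) (S.T3N P I) <
        1 / KTwoSat (S.schedTwoN F P) F (S.Bv3N F P) I x₁ τ := by
    intro I hI1 hI k hk x₁ hx₁ τ hτ
    have he := S.kExp_schedTwoN_le F P I (k := k) hk
    unfold kExp at he
    simp only [schedTwoN_tdec, schedTwoN_Nsub, schedTwoN_m] at he
    exact lt_of_le_of_lt (first_le_gain hBw (le_inv_two_pow_of_le he hΛE)) (hG.kstep I hI1 hI k hk x₁ hx₁ τ hτ)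
  have ht : ∀ I, I < S.Istar3N F P → ∀ s : ℤ, |s| ≤ (S.Nsub3N P (I + 1) 0 : ℤ) → ¬ (3 : ℤ) ∣ s →
      ∀ τ : Tau S.d, tauNorm τ < S.T03N F P (I + 1) →
      S.Bw3N F P * ‖S.Λ₀‖ * (2 : ℝ) ^ (S.T03N F P I - (S.d + 3) * S.T3N P I - S.T03N F P (I + 1)) *
          (2 : ℝ) ^ condExp 2 (2 * (3 ^ (S.d + 3) * S.Xs3N P I) + 1)
            (S.T03N F P I - (S.d + 3) * S.T3N P I - S.T03N F P (I + 1)) <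
        1 / (6 * (thirdDenSat (S.schedTwoN F P) F (S.Bv3N F P) Ucol I s τ : ℝ) *
          thirdMSat (S.schedTwoN F P) F (S.Bv3N F P) Ucol I s τ * heightProd S.toQ.all ^ 5) ^ (3 ^ (S.d + 1 + 1) - 1) := by
    intro I hI s hs h3 τ hτ
    have he := S.tExp_schedTwoN_le F P I
    unfold tExp at he
    simp only [schedTwoN_Tfin, schedTwoN_T0, schedTwoN_Nfin, schedTwoN_m] at he
    exact lt_of_le_of_lt (first_le_gain hBw (le_inv_two_pow_of_le he hΛE)) (hG.third I hI s hs h3 τ hτ)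
  exact ⟨hslab, hk0, hk, ht⟩

/-- **`GainSupplyTwoN → SmallSupplyTwoN C`** for every constant function with `2^{111·r} ≤ C r`: the line's `stub_smallTwoN`
(`SmallSupplyTwoN CLine`, `CLine r = (2^{111})^r`) follows from `stub_gainTwoN`. [cite: Yu2013, (5.19), (5.29); shape only] -/
theorem smallSupplyTwoN_of_gainSupply {C : ℕ → ℝ} (hC : ∀ r, (2 : ℝ) ^ (111 * r) ≤ C r) (hG : GainSupplyTwoN) :
    SmallSupplyTwoN C := by
  intro S F V Vmax W Ucol hd hV1 hVmax hW1 hs1 hs2 hs3 hs4 hs5 U hU hΛ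
  exact S.smallPackTwoN_of_gain F V Vmax W Ucol hd hV1 hVmax hW1 hs3 hs4
    (hG S F V Vmax W Ucol hd hV1 hVmax hW1 hs1 hs2 hs3 hs4 hs5) (hC (S.d + 1)) U hU hΛ

end TwoSetup

end Summit.ABC.StewartYu

end
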